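import Literature.Topology.FourManifolds.SurgeryBelowMiddleDimension
import Literature.Topology.FourManifolds.SphereSurgerySignatureTop
import HarnessLib

/-!
# Framed surgery below the middle dimension with the signature bookkeeping discharged

Topic `Literature/Topology/FourManifolds` (fact seat of
`Literature.Topology.FourManifolds.HomotopySphere.exists_highlyConnected_of_mem_signatureSet`,
brick B9d).  A. Kosinski, *Differential Manifolds* (1993), Ch. X §2, Thm. (2.2), p. 201, with
§3, Prop. (3.3), p. 206 ("`σ(M)` is an invariant of cobordism"); M. Kervaire, J. Milnor,
*Groups of homotopy spheres I*, Ann. of Math. 77 (1963), Thm. 5.5 and §7.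

`SurgeryBelowMiddleDimension.lean` reduces the named fact
`exists_highlyConnected_of_mem_signatureSet` to three plain hypotheses `(h_simply)`, `(h21)`,
`(h6)`.  The third — the invariance of the signature `σ` of the oriented null-cobordism under a
surgery of index `≤ 2m` on a `4m`-manifold bounded by a homotopy sphere — is now a THEOREM of the
tree (`NullCobordism.signatureInDim_surgery_eq_of_lt`, spheres of dimension `≤ 2m - 2`, and
`NullCobordism.signatureInDim_surgery_eq_of_eq`, spheres of dimension `2m - 1`; both proved
without Poincaré duality on the closed models, through the common collapse of the two closed
models).  This file re-runs the induction of X.2.2 with that input discharged: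

* `HomotopySphere.Stage.kill'`, `HomotopySphere.Stage.killAll'` — the inductive step with the
  orientation-and-signature bookkeeping in existential form;
* `HomotopySphere.exists_isOrientedBy_surgery_signatureInDim_eq` — the discharged `h6`;
* `HomotopySphere.exists_highlyConnected_of_mem_signatureSet_of'` — **Kosinski X.2.2 / X.3.3 for
  `P⁴ᵐ` reduced to the two remaining geometric inputs**: the simply-connected reduction
  `(h_simply)` (`0`- and `1`-surgeries) and framed representability with s-parallelizable trace
  `(h21)` (X.2.1: Whitney embedding + stability of `π_{j-1}(SO)`).

Everything is proved; no definitions, no named facts.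

## References

* A. Kosinski, *Differential Manifolds* (1993), Ch. X §2, Thm. (2.2) (proof, p. 201), §3
  Prop. (3.3), p. 206. [Kosinski1993]
* M. Kervaire, J. Milnor, *Groups of homotopy spheres I*, Ann. of Math. 77 (1963), Thm. 5.5,
  Lemma 5.6, §7 footnote pp. 528–529. [KervaireMilnorAnnals1963]
* A. Hatcher, *Algebraic Topology* (2002), Thm. 2A.1, Thm. 4.32. [HatcherAT2002]
-/

noncomputable section

open scoped Manifold ContDiff Topology ContinuousMap
open Set Function CategoryTheory Limits
open Literature.AlgebraicTopology.SingularHomology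

namespace Literature.Topology.FourManifolds

namespace HomotopySphere

/-! ### One surgery: killing a generator, with the signature bookkeeping in existential form -/

section Kill

variable {n : ℕ} {m : ℕ} {hdim : 2 * m + 2 * m = n + 1 + 1} {S : HomotopySphere (n + 1)} {σ : ℤ}
  {μ : HomologicalOrientation ℤ S.carrier (n + 1)}

/-- **Killing one generator** (Kosinski X.2.2, the inductive step, from X.1.1 and X.2.1): at level
`j = q + 2 ≤ 2m - 1`, a stage with `r + 1` generators yields a stage with `r` generators — as
`Stage.kill`, but with the re-orientation and the comparison of signatures supplied together
(`h6'`: SOME orientation `μ''` of the new closed model with `(Σ, μ) = bχ` and the same `σ`).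
[cite: Kosinski1993, Ch. X §2, Thm. 2.2 (proof)] -/
theorem Stage.kill'
    (h21 : ∀ (c : NullCobordism (n + 1) S.carrier), SimplyConnectedSpace c.W →
      IsStablyParallelizable (𝓡∂ (n + 1 + 1)) c.W → ∀ (q : ℕ), q + 3 ≤ 2 * m →
      ∀ f : C(Metric.sphere (0 : EuclideanSpace ℝ (Fin (q + 1 + 1 + 1))) 1, c.W),
        ∃ (l : ℕ) (hkl : q + 1 + 1 + l = n + 1)
          (ν : FramedSphereFamily (𝓡∂ (n + 1 + 1)) c.W Unit (q + 1 + 1) (l + 1)),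
          ν.sphereMap.Homotopic f ∧
            IsStablyParallelizable (𝓡∂ (n + 1 + 1)) (c.surgery ν hkl).W)
    (h6' : ∀ (c : NullCobordism (n + 1) S.carrier) (q l : ℕ) (hkl : q + 1 + 1 + l = n + 1)
      (ν : FramedSphereFamily (𝓡∂ (n + 1 + 1)) c.W Unit (q + 1 + 1) (l + 1))
      (μ' : HomologicalOrientation ℤ (ClosedModel (n + 1) c.W) (n + 1 + 1)),
      q + 3 ≤ 2 * m → c.IsOrientedBy μ μ' →
        ∃ μ'' : HomologicalOrientation ℤ (ClosedModel (n + 1) (c.surgery ν hkl).W) (n + 1 + 1),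
          (c.surgery ν hkl).IsOrientedBy μ μ'' ∧
            μ''.signatureInDim hdim = μ'.signatureInDim hdim)
    {q r : ℕ} (hq : q + 3 ≤ 2 * m)
    (hst : Stage m hdim S σ μ (q + 1 + 1) (r + 1)) : Stage m hdim S σ μ (q + 1 + 1) r := by
  classical
  obtain ⟨c, μ', hsc, hconn, ⟨G, hGcard, hGspan⟩, hpar, hob, hsig⟩ := hst
  haveI := hsc
  by_cases hG : G.card ≤ r
  · exact ⟨c, μ', hsc, hconn, ⟨G, hG, hGspan⟩, hpar, hob, hsig⟩
  obtain ⟨g₀, hg₀⟩ : G.Nonempty := Finset.card_pos.1 (by omega)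
  -- `W` is `(q+1)`-connected, so `g₀` is spherical
  have hπ : ∀ k : ℕ, 2 ≤ k → k < q + 2 → ∀ x : c.W, Subsingleton (π_ k c.W x) :=
    subsingleton_homotopyGroup_of_subsingleton_below (q + 2) hconn
  obtain ⟨f, θ, hfθ⟩ := exists_sphereMap_of_connected (X := c.W) q hπ g₀
  -- a framed embedded sphere in the class of `f` with s-parallelizable surgery
  obtain ⟨l, hkl, ν, hhom, hpar'⟩ := h21 c hsc hpar q hq f
  have hθ : singularHomology.map ℤ ℤ ν.sphereMap (q + 1 + 1) θ = g₀ := by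
    rw [singularHomology.map_eq_of_homotopic ℤ ℤ hhom]; exact hfθ
  have hml : q + 1 + 1 < l := by omega
  haveI : ConnectedSpace S.carrier := S.connectedSpace (Nat.succ_ne_zero n)
  haveI : Nonempty S.carrier := S.nonempty
  -- the surgery
  obtain ⟨G', hG'card, hG'span⟩ :=
    FramedSphereFamily.exists_generators_surgered ν hkl hml hGspan hg₀ hθ
  have hG'le : G'.card ≤ r := by omega
  obtain ⟨μ'', hob', hsig'⟩ := h6' c q l hkl ν μ' hq hob
  refine ⟨c.surgery ν hkl, μ'', ?_, ?_, ⟨G', hG'le, hG'span⟩, hpar', hob', ?_⟩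
  · exact FramedSphereFamily.simplyConnectedSpace_surgered ν hkl (by omega) (by omega)
  · intro i hi hiq
    obtain ⟨i', rfl⟩ : ∃ i', i = i' + 1 := ⟨i - 1, by omega⟩
    haveI := hconn (i' + 1) hi hiq
    have hz : IsZero (singularHomology ℤ ℤ c.W (i' + 1)) := ModuleCat.isZero_of_subsingleton _
    exact ModuleCat.subsingleton_of_isZero
      (FramedSphereFamily.isZero_singularHomology_surgered ν hkl ℤ ℤ (m := i') (by omega)
        (by omega) hz)
  · rw [hsig', hsig]

/-- Killing all the generators at one level (existential bookkeeping).
[cite: Kosinski1993, Ch. X §2, Thm. 2.2 (proof)] -/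
theorem Stage.killAll'
    (h21 : ∀ (c : NullCobordism (n + 1) S.carrier), SimplyConnectedSpace c.W →
      IsStablyParallelizable (𝓡∂ (n + 1 + 1)) c.W → ∀ (q : ℕ), q + 3 ≤ 2 * m →
      ∀ f : C(Metric.sphere (0 : EuclideanSpace ℝ (Fin (q + 1 + 1 + 1))) 1, c.W),
        ∃ (l : ℕ) (hkl : q + 1 + 1 + l = n + 1)
          (ν : FramedSphereFamily (𝓡∂ (n + 1 + 1)) c.W Unit (q + 1 + 1) (l + 1)),
          ν.sphereMap.Homotopic f ∧
            IsStablyParallelizable (𝓡∂ (n + 1 + 1)) (c.surgery ν hkl).W)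
    (h6' : ∀ (c : NullCobordism (n + 1) S.carrier) (q l : ℕ) (hkl : q + 1 + 1 + l = n + 1)
      (ν : FramedSphereFamily (𝓡∂ (n + 1 + 1)) c.W Unit (q + 1 + 1) (l + 1))
      (μ' : HomologicalOrientation ℤ (ClosedModel (n + 1) c.W) (n + 1 + 1)),
      q + 3 ≤ 2 * m → c.IsOrientedBy μ μ' →
        ∃ μ'' : HomologicalOrientation ℤ (ClosedModel (n + 1) (c.surgery ν hkl).W) (n + 1 + 1),
          (c.surgery ν hkl).IsOrientedBy μ μ'' ∧
            μ''.signatureInDim hdim = μ'.signatureInDim hdim)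
    {q : ℕ} (hq : q + 3 ≤ 2 * m) :
    ∀ r : ℕ, Stage m hdim S σ μ (q + 1 + 1) r → Stage m hdim S σ μ (q + 1 + 1) 0 := by
  intro r
  induction r with
  | zero => exact id
  | succ r ih => exact fun h ↦ ih (Stage.kill' h21 h6' hq h)

/-- **The discharged `h6`** (Kosinski X.3.3, p. 206 / Kervaire–Milnor §7): a surgery on a
framed `(q+2)`-sphere, `q + 3 ≤ 2m`, in a `4m`-dimensional null-cobordism of a homotopy sphere
(`1 < m`) admits an orientation of the new closed model with the same oriented boundary and the
same signature — `signatureInDim_surgery_eq_of_lt` for `q + 3 < 2m` and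
`signatureInDim_surgery_eq_of_eq` for `q + 3 = 2m`.
[cite: Kosinski1993, Ch. X §3, Prop. (3.3), p. 206] [cite: KervaireMilnorAnnals1963, §7, footnote pp. 528–529] -/
theorem exists_isOrientedBy_surgery_signatureInDim_eq (hm : 1 < m)
    (c : NullCobordism (n + 1) S.carrier) (q l : ℕ) (hkl : q + 1 + 1 + l = n + 1)
    (ν : FramedSphereFamily (𝓡∂ (n + 1 + 1)) c.W Unit (q + 1 + 1) (l + 1))
    (μ' : HomologicalOrientation ℤ (ClosedModel (n + 1) c.W) (n + 1 + 1))
    (hq : q + 3 ≤ 2 * m) (hob : c.IsOrientedBy μ μ') :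
    ∃ μ'' : HomologicalOrientation ℤ (ClosedModel (n + 1) (c.surgery ν hkl).W) (n + 1 + 1),
      (c.surgery ν hkl).IsOrientedBy μ μ'' ∧ μ''.signatureInDim hdim = μ'.signatureInDim hdim := by
  haveI : ConnectedSpace S.carrier := S.connectedSpace (Nat.succ_ne_zero n)
  haveI : Nonempty S.carrier := S.nonempty
  rcases (Nat.lt_or_eq_of_le hq) with hlt | heq
  · exact c.signatureInDim_surgery_eq_of_lt ν hkl hdim (by omega) (by omega) (by omega) hob
  · exact NullCobordism.signatureInDim_surgery_eq_of_eq S c ν hkl hdim (by omega)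
      (even_two_mul m) (by omega) hob

end Kill

/-! ### The reduction theorem with `σ` discharged -/

/-- **Kosinski X.2.2 / X.3.3 for `P⁴ᵐ`, reduced to X.2.1 and the `1`-connectivity step**: GIVEN
(as hypotheses) the simply-connected reduction (`h_simply`) and framed representability with
s-parallelizable surgery (`h21`, X.2.1), every element of `signatureSet g m h Σ` is the signature
of a simply connected s-parallelizable null-cobordism with `Hᵢ = 0` for `0 < i < 2m` and the same
oriented boundary — `HomotopySphere.exists_highlyConnected_of_mem_signatureSet`.  The invariance
of the signature under the surgeries (formerly the hypothesis `h6`) is the tree theorem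
`exists_isOrientedBy_surgery_signatureInDim_eq`. [cite: Kosinski1993, Ch. X §2, Thm. 2.2 (proof) and §3 Prop. (3.3), p. 206] -/
theorem exists_highlyConnected_of_mem_signatureSet_of'
    (h_simply : ∀ (n m : ℕ) (hdim : 2 * m + 2 * m = n + 1), 1 < m → ∀ (S : HomotopySphere n)
      (μ : HomologicalOrientation ℤ S.carrier n) (c : NullCobordism n S.carrier)
      (μ' : HomologicalOrientation ℤ (ClosedModel n c.W) (n + 1)),
      IsStablyParallelizable (𝓡∂ (n + 1)) c.W → c.IsOrientedBy μ μ' →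
        ∃ (c₁ : NullCobordism n S.carrier)
          (μ₁' : HomologicalOrientation ℤ (ClosedModel n c₁.W) (n + 1)),
          SimplyConnectedSpace c₁.W ∧ IsStablyParallelizable (𝓡∂ (n + 1)) c₁.W ∧
            c₁.IsOrientedBy μ μ₁' ∧ μ₁'.signatureInDim hdim = μ'.signatureInDim hdim)
    (h21 : ∀ (n m : ℕ), 2 * m + 2 * m = n + 1 → 1 < m → ∀ (S : HomotopySphere n)
      (c : NullCobordism n S.carrier), SimplyConnectedSpace c.W →
      IsStablyParallelizable (𝓡∂ (n + 1)) c.W → ∀ (q : ℕ), q + 3 ≤ 2 * m →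
        ∀ f : C(Metric.sphere (0 : EuclideanSpace ℝ (Fin (q + 1 + 1 + 1))) 1, c.W),
          ∃ (l : ℕ) (hkl : q + 1 + 1 + l = n)
            (ν : FramedSphereFamily (𝓡∂ (n + 1)) c.W Unit (q + 1 + 1) (l + 1)),
            ν.sphereMap.Homotopic f ∧ IsStablyParallelizable (𝓡∂ (n + 1)) (c.surgery ν hkl).W) :
    exists_highlyConnected_of_mem_signatureSet := by
  intro n m h hm g S σ hσ
  obtain ⟨n, rfl⟩ : ∃ n', n = n' + 1 := ⟨n - 1, by omega⟩
  have hdim : 2 * m + 2 * m = n + 1 + 1 := by omega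
  obtain ⟨μ, c, μ', hcompat, hpar, hob, hsig⟩ := mem_signatureSet_iff.1 hσ
  -- stage 2
  obtain ⟨c₁, μ₁', hsc₁, hpar₁, hob₁, hsig₁⟩ := h_simply (n + 1) m hdim hm S μ c μ' hpar hob
  have h2 : ∃ r, Stage m hdim S σ μ 2 r := by
    haveI := hsc₁
    obtain ⟨G, hG⟩ := exists_finset_span_eq_top (n := n + 1) c₁.W 2
    refine ⟨G.card, c₁, μ₁', hsc₁, fun i hi hi2 ↦ ?_, ⟨G, le_rfl, hG⟩, hpar₁, hob₁, ?_⟩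
    · obtain rfl : i = 1 := by omega
      exact subsingleton_singularHomology_one
    · rw [hsig₁]; exact hsig
  -- the induction on the level
  have key : ∀ q : ℕ, q + 2 ≤ 2 * m → ∃ r, Stage m hdim S σ μ (q + 2) r := by
    intro q
    induction q with
    | zero => exact fun _ ↦ h2
    | succ q ih =>
      intro hq
      obtain ⟨r, hr⟩ := ih (by omega)
      have h0 : Stage m hdim S σ μ (q + 1 + 1) 0 :=
        Stage.killAll' (h21 (n + 1) m hdim hm S)
          (fun c q l hkl ν μ' hq' hob' ↦
            exists_isOrientedBy_surgery_signatureInDim_eq hm c q l hkl ν μ' hq' hob')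
          (by omega) r hr
      obtain ⟨r', hr'⟩ := h0.up
      exact ⟨r', hr'⟩
  obtain ⟨r, c', μ'', hsc, hconn, -, hpar', hob', hsig'⟩ := key (2 * m - 2) (by omega)
  refine ⟨μ, c', μ'', hsc, fun i hi hi2 ↦ hconn i hi (by omega), hcompat, hpar', hob', ?_⟩
  exact hsig'

end HomotopySphere

end Literature.Topology.FourManifolds
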